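import Summits.BirchSwinnertonDyer.BirchSwinnertonDyer.Theorems.ErratumRoadFiveClassicalValueFromPrint
import Summits.BirchSwinnertonDyer.BirchSwinnertonDyer.Theorems.ErratumRoadFiveValueByNormContinuity
import HarnessLib

/-!
# Route `ErratumRoadFive`, crux `OpenInputNotRam` (item stmt-BirchSwinnertonDyer-19282), registered
# stub `stub_bdpValueNotRam` (H2 at `p ∥ N` on the (¬ram) atom, at EVERY `R₀`-frame) — FROM PRINT:
# Castella, J. Inst. Math. Jussieu 17 (2018) Thms. 2.10–2.11 (the value at `𝟙`, any conductor) +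
# one-sided ♭-value rigidity across periods + Gross–Zagier–Kolyvagin rank one

Cell `bsd-stepL` (run/shared/lean/pub/bsd-stepL/), seat `bsd-stepL-nram2` (prover, PART 1b residue
fan-out, 2026-08-26), `--supports stmt-BirchSwinnertonDyer-19282`. The registered BC3 skeleton
`Cruxes/OpenInputNotRam/Lines/birth.lean` (planner g25, sha16 b078920a0adb81b4) composes four mechanism
stubs into the crux by `OpenInputNotRam_of`; its third stub `stub_bdpValueNotRam` (H2) asks, at every
classical X11b datum of a (¬ram) pair (`p ≥ 5`, `ρ̄_{E,p}` onto, `K` an odd-discriminant strict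
Heegner field with `p ∤ d_K h`, a parametrisation datum `Dt` with `p ∤ c`, the Heegner point `P` of
infinite order read through `ι`, anticyclotomic `(κ, γ)`, a degree-one prime `𝔭 ∋ p`) and at EVERY
frame `(f, ι', Ω_K ≠ 0, Ω_p ∈ R₀ˣ, L ∈ R₀⟦T⟧)` with `ι'` inducing `𝔭` and Castella's interpolation
property `IsBDPLFunction ι' 𝔭 κ γ f Ω_K Ω_p L`, for the value at the trivial character:
`L(𝟙) = u·((1 − a_p(E) p⁻¹)·log_{ω_E} P)²` with `u ∈ R₀ˣ`, the logarithm along THE embedding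
`embAt K p 𝔭`.

HONEST FRAMING: BSD is NOT proved by any of this; a closed item closes a rung leaf (K2), never summit
credit; X11b stays CONSTRUCTION-SHAPED. THEOREMS ONLY (no definition, no named fact, no `sorry`);
CONDITIONAL on the three PUBLISHED named facts it lists: `thm210_thm211_bdpDisplay_pNew` (Castella
JIMJ 17 (2018) Thms. 2.10–2.11 with BDP 2013's display: the BDP value at `𝐍_K` of the `p`-NEW newform,
`p ≥ 5`, ANY conductor with `p ∥ N`, strict Heegner field — a reviewed Literature fact of cell
bsd-eis), `rank_eq_analyticRank_of_analyticRank_le_one` (Gross–Zagier–Kolyvagin) and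
`exists_isNewformOf` (modularity). The binders `¬ Ram W p`, `Odd d_K`-companions `¬ p ∣ d_K`,
`¬ p ∣ #𝓞_K^×` are idle or only threaded. No semistability is needed: the value half of the crux is
print on EVERY (¬ram) pair.

Proof (all tree theorems, nothing re-typed): `f = f_{Dt}` (multiplicity one, `IsNewformOf.unique`);
`𝔭 = 𝔭_{ι'}` is the prime of the embedding datum at the unique infinite place `w₀`
(`eq_primeOfEmbeddingDatum_of_forall_mem_iff`); the datum's `ι` is `w₀.embedding ∘ τ` for an
involution `τ ∈ Gal(K/ℚ)`, so `τ_* P` reads the Heegner point through `w₀`; THE embedding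
`e = embAt K p 𝔭` induces `𝔭` (`mem_asIdeal_iff_norm_embAt_lt_one`); bdp g12's
`continuousDisplayOnTree_of_pNew` (p442735) turns the JIMJ18 fact into the display's CONTINUITY AT `𝟙`
with non-zero limit `c = u·((1 − a_p p⁻¹)·log_{ω_E} τ_* P)²`, `‖u‖ = 1`, at virtual periods; ONE-SIDED
♭-V1RIG (`intSeries_constantCoeff_eq_of_isBDPLFunctionInt_of_continuousValues`, multr1-p2: odd `p`, `K`
imaginary quadratic, `κ` anticyclotomic, `γ` a topological generator, ANY non-zero frame periods)
applied to `L` read in `𝓞_{ℂ_p}⟦T⟧` (`R1.isBDPLFunctionInt_map`) gives `[T⁰]L = c`; since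
`[T⁰]L ∈ R₀` and `((1 − a_p p⁻¹)·log τ_* P)² ∈ ℚ_p^×`, the norm-one scalar is a unit of `R₀`
(`exists_unit_unrIntegers_mul_eq_of_norm_eq`, bdp g11); finally `(log_{ω_E} τ_* P)² = (log_{ω_E} P)²`
in rank one (`R1.bdpValueAtOneOnTreeAt_map_iff_of_rank_one`; `rank_ℤ E(K) = 1` by
`mordellWeilRank_baseChange_eq_one_of_twist_ne_zero` from GZK + modularity + `L(E^{d_K},1) ≠ 0`).

* `openInputNotRam_stub_bdpValueNotRam_of_pNew` — the registered signature of
  `Cruxes.OpenInputNotRam.Birth.stub_bdpValueNotRam` VERBATIM (fully qualified; the skeleton-local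
  abbreviation `InducesPrimeAt p ι' 𝔭` written out as its body
  `∀ (w : InfinitePlace K) (k : 𝓞 K), k ∈ 𝔭.asIdeal ↔ ‖ι'.symm (w.embedding (k : K))‖ < 1`, to which it
  is definitionally equal), after the three fact hypotheses.

References: [Castella2018Exceptional] Thms. 2.10–2.11 (arXiv:1507.04260 pp. 13–14);
[BertoliniDarmonPrasanna2013] Thm. 5.13, Prop. 5.10; [Castella2018] Thms. 3.1–3.2 (arXiv:1704.06608
p. 9) (the shape); [GrossZagier1986] Thm. I.6.3; [Kolyvagin1990] Thm. A.
-/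

set_option autoImplicit false
set_option linter.dupNamespace false

noncomputable section

open scoped Classical Topology

open Filter WeierstrassCurve NumberField IsDedekindDomain Field PowerSeries
open Literature.NumberTheory.EllipticCurves Literature.NumberTheory.EllipticCurves.ModularForms
  Literature.NumberTheory.EllipticCurves.Rank1Residual
  Literature.NumberTheory.EllipticCurves.Castella2018
  Literature.NumberTheory.EllipticCurves.Castella2018Exceptional
  Literature.NumberTheory.GaloisRepresentations
open Summit.BirchSwinnertonDyer.Rank1Residual Summit.BirchSwinnertonDyer.Rank1Residual.X11b
  Summit.BirchSwinnertonDyer.Rank1Residual.X11b.AcSelmer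
  Summit.BirchSwinnertonDyer.Rank1Residual.X11b.Halves

namespace Summit.BirchSwinnertonDyer.BirchSwinnertonDyer.Theorems

/-- **Stub `stub_bdpValueNotRam` of crux `OpenInputNotRam` (item 19282) FROM PRINT.** At every classical
X11b datum of a (¬ram) pair — the registered binders VERBATIM — and every frame
`(f, ι', Ω_K ≠ 0, Ω_p ∈ R₀ˣ, L)` with `ι'` inducing `𝔭` and `IsBDPLFunction ι' 𝔭 κ γ f Ω_K Ω_p L`:
`∃ u ∈ R₀ˣ, L(𝟙) = u·((1 − a_p(E) p⁻¹)·log_{ω_E} P)²`, the logarithm along `embAt K p 𝔭`. Proof in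
the module docstring: JIMJ18 Thms. 2.10–2.11 (`continuousDisplayOnTree_of_pNew`) + one-sided ♭-value
rigidity across periods + `R₀`-unit from the norm + rank-one symmetry `(log τ_* P)² = (log P)²`.
CONDITIONAL on the three named facts; nothing booked; the binder `¬ Ram W p` is idle.
[cite: Castella2018Exceptional, Thm. 2.10 and Thm. 2.11 with Prop. 2.7 (arXiv:1507.04260 pp. 13–14)]
[cite: BertoliniDarmonPrasanna2013, Thm. 5.13 and Prop. 5.10]
[cite: Castella2018, Thm. 3.2 with (3.2)–(3.3) (arXiv:1704.06608 p. 9) (shape)]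
[cite: GrossZagier1986, Thm. I.6.3] [cite: Kolyvagin1990, Thm. A] -/
theorem openInputNotRam_stub_bdpValueNotRam_of_pNew (hB : thm210_thm211_bdpDisplay_pNew)
    (hGZK : rank_eq_analyticRank_of_analyticRank_le_one) (hnf : exists_isNewformOf) :
    ∀ (W : WeierstrassCurve ℚ) [W.IsElliptic] [W.IsGloballyMinimal] (p : ℕ) [Fact p.Prime]
      (N : ℕ) [NeZero N] (K : Type) [Field K] [NumberField K]
      (Dt : ModularParametrizationData W N) (H : HeegnerDatum N (NumberField.discr K)) (ι : K →+* ℂ)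
      (P : (W.baseChange K).toAffine.Point),
      ¬ Literature.NumberTheory.EllipticCurves.Rank1Residual.Ram W p →
      ClassX11b W p → 5 ≤ p → Surj W p → W.conductorNorm ℤ = N → IsImaginaryQuadratic K →
      Odd (NumberField.discr K) → ¬ (p : ℤ) ∣ NumberField.discr K → ¬ p ∣ Units.torsionOrder K →
      SatisfiesHeegnerHypothesis N K →
      (W.quadraticTwist (NumberField.discr K : ℚ)).entireLFunction 1 ≠ 0 →
      WeierstrassCurve.Affine.Point.map ι.toRatAlgHom P = heegnerPointComplex Dt H →
      ¬ (p : ℤ) ∣ Dt.c → ¬ IsOfFinAddOrder P →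
      ∀ (κ : ZpExtension K p), κ.IsAnticyclotomic →
        ∀ (γ : Field.absoluteGaloisGroup K) [Fact (κ.IsTopGenerator γ)]
          (𝔭 : HeightOneSpectrum (𝓞 K)) (h𝔭 : ((p : ℕ) : 𝓞 K) ∈ 𝔭.asIdeal)
          (he : 𝔭.asIdeal.ramificationIdx (𝓞 ℚ) = 1) (hf : 𝔭.asIdeal.inertiaDeg (𝓞 ℚ) = 1),
          ∀ (f : CuspForm (CongruenceSubgroup.Gamma0 N) 2), IsNewformOf W f →
            ∀ (ι' : PadicAlgCl p ≃+* ℂ),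
              (∀ (w : InfinitePlace K) (k : 𝓞 K),
                k ∈ 𝔭.asIdeal ↔ ‖ι'.symm (w.embedding (k : K))‖ < 1) →
              ∀ (ΩK : ℂ) (Ωp : (unrIntegers p)ˣ) (L : UnrSeries p), ΩK ≠ 0 →
                IsBDPLFunction ι' 𝔭 κ γ f ΩK ((Ωp : unrIntegers p) : ℂ_[p]) L →
                  ∃ u : (unrIntegers p)ˣ, L.HasValueAt 0 (((u : unrIntegers p) : ℂ_[p]) *
                    (algebraMap ℚ_[p] ℂ_[p] (((1 : ℚ_[p]) - ((W.LFunction p : ℤ) : ℚ_[p]) *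
                      (p : ℚ_[p])⁻¹) * logOmega W p (embAt K p 𝔭 h𝔭 he hf) P)) ^ 2) := by
  intro W _ _ p _ N _ K _ _ Dt H ιK P _hnr hX h5 hs hN hK hodd hpd hμ hHN hLt hP hc hPinf κ hκ γ hγ 𝔭
    h𝔭 he hf f hfW ι' hι' ΩK Ωp L hΩK hL
  -- multiplicity one: the frame's newform is `f_{Dt}`
  obtain rfl : f = Dt.f := hfW.unique Dt.isNewformOf
  have hr : W.analyticRank = 1 := hX.1
  have hp2 : p ≠ 2 := hX.2.1
  -- one infinite place; `𝔭` is the prime of the embedding datum `ι'` there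
  obtain ⟨w₀⟩ := (inferInstance : Nonempty (InfinitePlace K))
  obtain rfl : 𝔭 = primeOfEmbeddingDatum p ι' w₀.embedding :=
    eq_primeOfEmbeddingDatum_of_forall_mem_iff p ι' w₀.embedding (hι' w₀)
  -- `rank_ℤ E(K) = 1` (Gross–Zagier–Kolyvagin at the classical Heegner field)
  have hrk : (W.baseChange K).mordellWeilRank = 1 :=
    mordellWeilRank_baseChange_eq_one_of_twist_ne_zero W hGZK hnf hr hK.1 hLt
  -- the datum's complex embedding is `w₀.embedding ∘ τ` for an involution `τ ∈ Gal(K/ℚ)`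
  haveI : IsGalois ℚ K := by
    haveI : Algebra.IsQuadraticExtension ℚ K := ⟨hK.1⟩
    infer_instance
  obtain ⟨σ, hσ⟩ := ComplexEmbedding.exists_comp_symm_eq_of_comp_eq (k := ℚ) w₀.embedding ιK
    (by ext x; simp)
  set τ : K →+* K := ((σ.symm : K ≃ₐ[ℚ] K) : K →+* K) with hτdef
  have hτ : ∀ x, τ (τ x) = x := by
    intro x
    have hcard : Nat.card (K ≃ₐ[ℚ] K) = 2 := by rw [IsGalois.card_aut_eq_finrank, hK.1]
    have hsq : σ.symm * σ.symm = 1 := by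
      have h := pow_card_eq_one' (G := K ≃ₐ[ℚ] K) (x := σ.symm)
      rwa [hcard, pow_two] at h
    have := congrArg (fun g : K ≃ₐ[ℚ] K ↦ g x) hsq
    simpa [hτdef, AlgEquiv.mul_apply] using this
  -- the Galois conjugate `P' = τ_* P` is the Heegner point read through `w₀.embedding`
  set P' := WeierstrassCurve.Affine.Point.map τ.toRatAlgHom P with hP'def
  have hP' : WeierstrassCurve.Affine.Point.map w₀.embedding.toRatAlgHom P' =
      heegnerPointComplex Dt H := by
    rw [hP'def, WeierstrassCurve.Affine.Point.map_map]
    have hcomp : w₀.embedding.toRatAlgHom.comp τ.toRatAlgHom = ιK.toRatAlgHom := by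
      apply AlgHom.ext
      intro x
      have := RingHom.congr_fun hσ x
      simpa [hτdef] using this
    rw [hcomp]
    exact hP
  -- THE embedding at `𝔭` induces `𝔭`
  set e : K →+* ℚ_[p] := embAt K p (primeOfEmbeddingDatum p ι' w₀.embedding) h𝔭 he hf with hedef
  have hemb : ∀ k : 𝓞 K,
      k ∈ (primeOfEmbeddingDatum p ι' w₀.embedding).asIdeal ↔ ‖e (k : K)‖ < 1 :=
    mem_asIdeal_iff_norm_embAt_lt_one _ h𝔭 he hf
  -- the display's continuity at `𝟙`, with non-zero limit, from the JIMJ18 fact (bdp g12)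
  obtain ⟨ΩK₀, Ωp₀, u, hΩK₀, hΩp₀, hu, hc0, hcont⟩ := continuousDisplayOnTree_of_pNew hB N K Dt H ιK P
    hX h5 hs hN hK hodd hpd hμ hHN hLt hP hc hPinf κ hκ γ ι' w₀ P' hP' e hemb
  -- one-sided ♭-value rigidity across periods: the constant term of `L` is the limit
  have hΩp : ((Ωp : unrIntegers p) : ℂ_[p]) ≠ 0 := by
    rw [Ne, ZeroMemClass.coe_eq_zero]
    exact Units.ne_zero Ωp
  have heq := intSeries_constantCoeff_eq_of_isBDPLFunctionInt_of_continuousValues hp2 hK hκ hγ.out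
    hΩK₀ hΩK hΩp₀ hΩp hcont hc0 (R1.isBDPLFunctionInt_map hL)
  set X : ℚ_[p] := ((1 : ℚ_[p]) - ((W.LFunction p : ℤ) : ℚ_[p]) * (p : ℚ_[p])⁻¹) *
    logOmega W p e P' with hXdef
  have hcoe : ((PowerSeries.constantCoeff L : unrIntegers p) : ℂ_[p]) =
      u * (algebraMap ℚ_[p] ℂ_[p] X) ^ 2 := by
    rw [← heq, ← coeff_zero_eq_constantCoeff_apply (PowerSeries.map (R1.unrToCpInt p) L),
      PowerSeries.coeff_map, coeff_zero_eq_constantCoeff_apply, R1.coe_unrToCpInt]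
  -- the norm-one scalar is a unit of `R₀`
  have hX0 : algebraMap ℚ_[p] ℂ_[p] X ≠ 0 := by
    intro h0
    apply hc0
    rw [h0, zero_pow two_ne_zero, mul_zero]
  have hX0' : X ^ 2 ≠ 0 :=
    pow_ne_zero 2 ((map_ne_zero_iff _ (algebraMap ℚ_[p] ℂ_[p]).injective).mp hX0)
  have hnorm : ‖((PowerSeries.constantCoeff L : unrIntegers p) : ℂ_[p])‖ =
      ‖algebraMap ℚ_[p] ℂ_[p] (X ^ 2)‖ := by
    rw [hcoe, norm_mul, hu, one_mul, map_pow]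
  obtain ⟨u₀, hu₀⟩ := exists_unit_unrIntegers_mul_eq_of_norm_eq (PowerSeries.constantCoeff L) hX0' hnorm
  -- the value shape at `τ_* P`, then at `P` by rank-one symmetry
  have hval' : R1.BDPValueAtOneOnTreeAt W p e P' L (W.LFunction p) := by
    refine ⟨u₀, ?_⟩
    have h0 := UnrSeries.hasValueAt_zero L
    rw [← hu₀, map_pow] at h0
    exact h0
  exact (R1.bdpValueAtOneOnTreeAt_map_iff_of_rank_one W p e τ hτ hrk hPinf L (W.LFunction p)).mp hval'

end Summit.BirchSwinnertonDyer.BirchSwinnertonDyer.Theorems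

end
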